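import Summits.Ventures.PercRepro.S1KillCells

/-!
# PercRepro — THE KILL OF A MIXED FAMILY: TRIANGLES AND FOUR-CIRCUITS TOGETHER (p2, gen 26; SUBCLAIM-S1 §6.10)

`midCount_ge_K7_kill` priced the kill of `m` circuits of ONE size `k`. Row 9 needs both at once: the `t = 0, 1, 2`
lines of `(9, 9)` close only with `3 / 2 / 1` four-circuits next to the `0 / 1 / 2` triangles. Bonferroni's bound is
per-member anyway: `Σ_C C(n − |C|, p − |C|) ≤ |⋃| + C(m, 2)·C(n − 5, p − 5)` for a family whose members pairwise
cover `≥ 5` points — a triangle and a four-circuit do (they share `≤ 2` points).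

* `sum_le_card_biUnion_add_choose_two_mul` — Bonferroni with per-member sizes;
* `five_le_ncard_union_of_triangle_four_circuit` — a triangle and a four-circuit cover `≥ 5` points;
* **`midCount_ge_K7_kill_mixed`** — the `Y`-side bound with the kill of `m₃` triangles and `m₄` four-circuits.
Axioms: standard.
-/

open scoped Matroid

namespace PercRepro

namespace S1

open Set

variable {α : Type}

/-- **Bonferroni with per-member sizes**: sets `K i` of size `≥ a i` with pairwise intersections of size `≤ o` have
a union of size `≥ Σ a i − C(m, 2)·o`, in the additive form `Σ a i ≤ |⋃| + C(m, 2)·o`. -/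
theorem sum_le_card_biUnion_add_choose_two_mul {ι β : Type*} [DecidableEq ι] [DecidableEq β]
    (s : Finset ι) (K : ι → Finset β) (a : ι → ℕ) (o : ℕ) (ha : ∀ i ∈ s, a i ≤ (K i).card)
    (ho : ∀ i ∈ s, ∀ j ∈ s, i ≠ j → (K i ∩ K j).card ≤ o) :
    ∑ i ∈ s, a i ≤ (s.biUnion K).card + s.card.choose 2 * o := by
  have h := two_mul_sum_card_le_two_mul_card_biUnion_add s K
  have h1 : ∑ i ∈ s, a i ≤ ∑ i ∈ s, (K i).card := Finset.sum_le_sum ha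
  have h2 : ∑ i ∈ s, ∑ j ∈ s.erase i, (K i ∩ K j).card ≤ s.card * (s.card - 1) * o := by
    calc ∑ i ∈ s, ∑ j ∈ s.erase i, (K i ∩ K j).card ≤ ∑ i ∈ s, ∑ _j ∈ s.erase i, o := by
          apply Finset.sum_le_sum
          intro i hi
          apply Finset.sum_le_sum
          intro j hj
          exact ho i hi j (Finset.mem_of_mem_erase hj) (Finset.ne_of_mem_erase hj).symm
      _ = ∑ i ∈ s, (s.card - 1) * o := by
          apply Finset.sum_congr rfl
          intro i hi
          rw [Finset.sum_const, smul_eq_mul, Finset.card_erase_of_mem hi]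
      _ = s.card * (s.card - 1) * o := by rw [Finset.sum_const, smul_eq_mul]; ring
  have h3 : s.card * (s.card - 1) = 2 * s.card.choose 2 := by
    rw [Nat.choose_two_right]
    exact (Nat.two_mul_div_two_of_even (Nat.even_mul_pred_self _)).symm
  nlinarith [h, h1, h2, h3]

/-- **A triangle and a four-circuit cover `≥ 5` points**: distinct circuits never contain one another, so they share
`≤ 2` points. -/
theorem five_le_ncard_union_of_triangle_four_circuit (M : Matroid α) [M.Finite] {C C' : Set α}
    (hC : M.IsCircuit C ∧ C.ncard = 3) (hC' : M.IsCircuit C' ∧ C'.ncard = 4) :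
    5 ≤ (C ∪ C').ncard := by
  have hfin : C.Finite := M.ground_finite.subset hC.1.subset_ground
  have hfin' : C'.Finite := M.ground_finite.subset hC'.1.subset_ground
  have hss : C' ⊂ C ∪ C' := by
    refine ⟨Set.subset_union_right, fun h => ?_⟩
    have hCC' : C ⊆ C' := Set.subset_union_left.trans h
    have := hC.1.eq_of_subset_isCircuit hC'.1 hCC'
    rw [this] at hC
    omega
  have h := Set.ncard_lt_ncard hss (hfin.union hfin')
  omega

/-- **The `Y`-side bound with a MIXED kill**: on a core with (C1)–(C3) and nullity `d`, for `m₃` triangles and `m₄`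
four-circuits pairwise covering `≥ 5` points, `Σ_{j=5}^{p−1} C(n, j) + m₃·C(n − 3, p − 3) + m₄·C(n − 4, p − 4) ≤
#Y(p, 4) + (the `R₃`, `R₄` terms)/7560 + C(m₃ + m₄, 2)·C(n − 5, p − 5)`. -/
theorem midCount_ge_K7_kill_mixed (M : Matroid α) [M.Finite]
    (hcirc : ∀ C, M.IsCircuit C → 3 ≤ C.encard)
    (hline : ∀ L ⊆ M.E, M.eRk L ≤ 2 → L.ncard ≤ 3) (hplane : ∀ P ⊆ M.E, M.eRk P ≤ 3 → P.ncard ≤ 6)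
    (hten : ∀ X ⊆ M.E, M.eRk X ≤ 4 → X.ncard ≤ 10) {d : ℕ} (hd : M.E.encard = M.eRank + d) (p : ℕ) (hp : 5 ≤ p)
    (𝒯₃ 𝒯₄ : Finset (Set α)) (h𝒯₃ : ∀ C ∈ 𝒯₃, M.IsCircuit C ∧ C.ncard = 3) (h𝒯₄ : ∀ C ∈ 𝒯₄, M.IsCircuit C ∧ C.ncard = 4)
    (hpair : ∀ C ∈ 𝒯₃ ∪ 𝒯₄, ∀ C' ∈ 𝒯₃ ∪ 𝒯₄, C ≠ C' → 5 ≤ (C ∪ C').ncard) :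
    7560 * (∑ j ∈ Finset.Ico 5 p, M.E.ncard.choose j +
        (𝒯₃.card * (M.E.ncard - 3).choose (p - 3) + 𝒯₄.card * (M.E.ncard - 4).choose (p - 4))) ≤
      7560 * Matroid.midCount M p 4 +
      10584 * ({C : Set α | M.IsCircuit C ∧ C.ncard = 3}.ncard * (M.E.ncard - 3) +
        {C : Set α | M.IsCircuit C ∧ C.ncard = 4}.ncard) +
      (RSK 10 * ({C : Set α | M.IsCircuit C ∧ C.ncard = 3}.ncard * (M.E.ncard - 3).choose 2 +
        {C : Set α | M.IsCircuit C ∧ C.ncard = 4}.ncard * (M.E.ncard - 4) +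
        {C : Set α | M.IsCircuit C ∧ C.ncard = 5}.ncard) +
      (RBK 10 - RSK 10) * ({C : Set α | M.IsCircuit C ∧ C.ncard = 3}.ncard * (min (5 * d) M.E.ncard - 3).choose 2 +
        {C : Set α | M.IsCircuit C ∧ C.ncard = 4}.ncard * (min (5 * d) M.E.ncard - 4) +
        {C : Set α | M.IsCircuit C ∧ C.ncard = 5}.ncard)) +
      7560 * ((𝒯₃.card + 𝒯₄.card).choose 2 * (M.E.ncard - 5).choose (p - 5)) := by
  classical
  -- the mixed family
  set 𝒯 := 𝒯₃ ∪ 𝒯₄ with h𝒯def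
  have hdisj34 : Disjoint 𝒯₃ 𝒯₄ := by
    rw [Finset.disjoint_left]
    intro C h3 h4
    have := (h𝒯₃ C h3).2
    have := (h𝒯₄ C h4).2
    omega
  have h𝒯card : 𝒯.card = 𝒯₃.card + 𝒯₄.card := Finset.card_union_of_disjoint hdisj34
  have h𝒯 : ∀ C ∈ 𝒯, M.IsCircuit C ∧ (C.ncard = 3 ∨ C.ncard = 4) := by
    intro C hC
    rw [h𝒯def, Finset.mem_union] at hC
    rcases hC with h | h
    · exact ⟨(h𝒯₃ C h).1, Or.inl (h𝒯₃ C h).2⟩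
    · exact ⟨(h𝒯₄ C h).1, Or.inr (h𝒯₄ C h).2⟩
  have hkp : ∀ C ∈ 𝒯, C.ncard ≤ p := fun C hC => by rcases (h𝒯 C hC).2 with h | h <;> omega
  have hY3 := five_mul_ncard_rankLe3_ge_five_le M hcirc hline hplane
  have hY2 := ncard_rankEq4_ge_five_le_K M hcirc hline hplane hten hd
  have hEfin : M.E.Finite := M.ground_finite
  set Ef := hEfin.toFinset with hEf
  -- the sets with `5 ≤ |A| ≤ p − 1`
  set 𝓑 : ℕ → Finset (Set α) := fun j => (Ef.powersetCard j).image (fun s : Finset α => (s : Set α)) with h𝓑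
  have h𝓑card : ∀ j, (𝓑 j).card = M.E.ncard.choose j := fun j => by
    rw [h𝓑]; exact card_image_powersetCard hEfin j
  have hmem𝓑 : ∀ j A, A ∈ 𝓑 j ↔ A ⊆ M.E ∧ A.ncard = j := fun j A =>
    mem_image_powersetCard_iff hEfin j A
  have hdisj : ((Finset.Ico 5 p : Finset ℕ) : Set ℕ).PairwiseDisjoint 𝓑 := by
    intro i _ j _ hij
    rw [Function.onFun, Finset.disjoint_left]
    intro A hA hA'
    rw [hmem𝓑] at hA hA'
    exact hij (hA.2.symm.trans hA'.2)
  set W := (Finset.Ico 5 p).biUnion 𝓑 with hW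
  have hWcard : W.card = ∑ j ∈ Finset.Ico 5 p, M.E.ncard.choose j := by
    rw [hW, Finset.card_biUnion hdisj]
    exact Finset.sum_congr rfl (fun j _ => h𝓑card j)
  have hmemW : ∀ A ∈ W, A ⊆ M.E ∧ 5 ≤ A.ncard ∧ A.ncard < p := by
    intro A hA
    rw [hW, Finset.mem_biUnion] at hA
    obtain ⟨j, hj, hAj⟩ := hA
    rw [Finset.mem_Ico] at hj
    rw [hmem𝓑] at hAj
    exact ⟨hAj.1, by omega, by omega⟩
  -- the kill: the `p`-sets through the triangles of `𝒯`
  set Kf : Set α → Finset (Set α) := fun C => oversets hEfin C (p - C.ncard) with hKf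
  set KK := 𝒯.biUnion Kf with hKK
  have hmemK : ∀ A ∈ KK, A ⊆ M.E ∧ A.ncard = p ∧ ∃ C ∈ 𝒯, C ⊆ A := by
    intro A hA
    rw [hKK, Finset.mem_biUnion] at hA
    obtain ⟨C, hC, hAC⟩ := hA
    have hCE : C ⊆ M.E := (h𝒯 C hC).1.subset_ground
    have hcard := ncard_of_mem_oversets hEfin hCE (p - C.ncard) hAC
    rw [hKf] at hAC
    rw [mem_oversets hEfin hCE] at hAC
    refine ⟨hAC.2.1, ?_, C, hC, hAC.1⟩
    rw [hcard]
    have := hkp C hC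
    omega
  have hKcard : ∑ C ∈ 𝒯, (M.E.ncard - C.ncard).choose (p - C.ncard) ≤
      KK.card + 𝒯.card.choose 2 * (M.E.ncard - 5).choose (p - 5) := by
    refine sum_le_card_biUnion_add_choose_two_mul 𝒯 Kf _ _ ?_ ?_
    · intro C hC
      have hCE : C ⊆ M.E := (h𝒯 C hC).1.subset_ground
      rw [hKf]
      simp only
      rw [card_oversets hEfin hCE]
    · intro C hC C' hC' hne
      have hCE : C ⊆ M.E := (h𝒯 C hC).1.subset_ground
      have hC'E : C' ⊆ M.E := (h𝒯 C' hC').1.subset_ground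
      have h5 := hpair C hC C' hC' hne
      obtain ⟨X, hXsub, hX5⟩ := Set.exists_subset_card_eq h5
      have hXE : X ⊆ M.E := hXsub.trans (Set.union_subset hCE hC'E)
      have hsub : Kf C ∩ Kf C' ⊆ oversets hEfin X (p - 5) := by
        intro Q hQ
        rw [Finset.mem_inter] at hQ
        have hQ1 := hQ.1
        have hQcard := ncard_of_mem_oversets hEfin hCE (p - C.ncard) hQ.1
        rw [hKf] at hQ
        simp only at hQ
        rw [mem_oversets hEfin hCE] at hQ
        have hQ2 := hQ.2
        rw [mem_oversets hEfin hC'E] at hQ2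
        rw [mem_oversets hEfin hXE]
        refine ⟨hXsub.trans (Set.union_subset hQ.1.1 hQ2.1), hQ.1.2.1, ?_⟩
        have hQfin : Q.Finite := hEfin.subset hQ.1.2.1
        have hXQ : X ⊆ Q := hXsub.trans (Set.union_subset hQ.1.1 hQ2.1)
        rw [Set.ncard_sdiff hXQ (hQfin.subset hXQ), hQcard, hX5]
        have := hkp C hC
        omega
      calc (Kf C ∩ Kf C').card ≤ (oversets hEfin X (p - 5)).card := Finset.card_le_card hsub
        _ = (M.E.ncard - 5).choose (p - 5) := by rw [card_oversets hEfin hXE, hX5]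
  -- `W ∪ KK ⊆ Y ∪ T₃ ∪ T₄`, and `W`, `KK` are disjoint (sizes `< p` versus `= p`)
  set Y := {A : Set α | A ⊆ M.E ∧ (4 : ℕ∞) < M.eRk A ∧ M.eRk A < (p : ℕ∞)} with hY
  set T₃ := {A : Set α | A ⊆ M.E ∧ M.eRk A ≤ 3 ∧ 5 ≤ A.ncard} with hT₃
  set T₄ := {A : Set α | A ⊆ M.E ∧ M.eRk A = 4 ∧ 5 ≤ A.ncard} with hT₄
  have hclass : ∀ A, A ⊆ M.E → 5 ≤ A.ncard → M.eRk A < (p : ℕ∞) → A ∈ Y ∪ T₃ ∪ T₄ := by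
    intro A hAE h5 hlt
    by_cases h4 : (4 : ℕ∞) < M.eRk A
    · exact Or.inl (Or.inl ⟨hAE, h4, hlt⟩)
    · push Not at h4
      rcases h4.lt_or_eq with h | h
      · have h3 : M.eRk A ≤ 3 := by
          have : M.eRk A < (3 : ℕ∞) + 1 := by rw [show ((3 : ℕ∞) + 1) = 4 by norm_num]; exact h
          simpa using Order.le_of_lt_add_one this
        exact Or.inl (Or.inr ⟨hAE, h3, h5⟩)
      · exact Or.inr ⟨hAE, h, h5⟩
  have hsub : ((W ∪ KK : Finset (Set α)) : Set (Set α)) ⊆ Y ∪ T₃ ∪ T₄ := by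
    intro A hA
    rw [Finset.mem_coe, Finset.mem_union] at hA
    rcases hA with hA | hA
    · obtain ⟨hAE, h5, hlt⟩ := hmemW A hA
      have hAfin : A.Finite := hEfin.subset hAE
      refine hclass A hAE h5 ?_
      calc M.eRk A ≤ A.encard := M.eRk_le_encard A
        _ = (A.ncard : ℕ∞) := hAfin.cast_ncard_eq.symm
        _ < (p : ℕ∞) := by exact_mod_cast hlt
    · obtain ⟨hAE, hAp, C, hC, hCA⟩ := hmemK A hA
      exact hclass A hAE (by omega) (eRk_lt_of_circuit_subset M (h𝒯 C hC).1 hCA hAE hAp)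
  have hWK : Disjoint W KK := by
    rw [Finset.disjoint_left]
    intro A hAW hAK
    have h1 := (hmemW A hAW).2.2
    have h2 := (hmemK A hAK).2.1
    omega
  have hYfin : Y.Finite := hEfin.finite_subsets.subset (fun A hA => hA.1)
  have hT₃fin : T₃.Finite := hEfin.finite_subsets.subset (fun A hA => hA.1)
  have hT₄fin : T₄.Finite := hEfin.finite_subsets.subset (fun A hA => hA.1)
  have hWle : W.card + KK.card ≤ Y.ncard + T₃.ncard + T₄.ncard := by
    calc W.card + KK.card = (W ∪ KK).card := (Finset.card_union_of_disjoint hWK).symm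
      _ = ((W ∪ KK : Finset (Set α)) : Set (Set α)).ncard := (Set.ncard_coe_finset _).symm
      _ ≤ (Y ∪ T₃ ∪ T₄).ncard := Set.ncard_le_ncard hsub ((hYfin.union hT₃fin).union hT₄fin)
      _ ≤ (Y ∪ T₃).ncard + T₄.ncard := Set.ncard_union_le _ _
      _ ≤ Y.ncard + T₃.ncard + T₄.ncard := by
          have := Set.ncard_union_le Y T₃
          omega
  have hmid : Matroid.midCount M p 4 = Y.ncard := rfl
  -- the kill sum in the `m₃ / m₄` form
  have hsum : ∑ C ∈ 𝒯, (M.E.ncard - C.ncard).choose (p - C.ncard) =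
      𝒯₃.card * (M.E.ncard - 3).choose (p - 3) + 𝒯₄.card * (M.E.ncard - 4).choose (p - 4) := by
    rw [h𝒯def, Finset.sum_union hdisj34]
    congr 1
    · rw [Finset.sum_congr rfl (fun C hC => by rw [(h𝒯₃ C hC).2]), Finset.sum_const, smul_eq_mul]
    · rw [Finset.sum_congr rfl (fun C hC => by rw [(h𝒯₄ C hC).2]), Finset.sum_const, smul_eq_mul]
  rw [hsum, h𝒯card] at hKcard
  rw [← hWcard, hmid]
  have hY3' : 5 * T₃.ncard ≤ 7 * ({C : Set α | M.IsCircuit C ∧ C.ncard = 3}.ncard * (M.E.ncard - 3) +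
      {C : Set α | M.IsCircuit C ∧ C.ncard = 4}.ncard) := hY3
  have hY2' : 7560 * T₄.ncard ≤ _ := hY2
  nlinarith [hWle, hY3', hY2', hKcard]


end S1

end PercRepro
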